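import Literature.InformationTheory.QuantumCodes.RotatedSurfaceCodeCrossingPathsBound
import Literature.InformationTheory.QuantumCodes.InhomogeneousDensityBound
import HarnessLib

/-!
# The rotated-surface-code crossing-path counting bound with INHOMOGENEOUS independent noise (qubit-dependent rates `≤ ρ`):
# `Prob[odd column-0 residual] ≤ L·C·s^L/(1-s)`, `s = 2ν√(ρ(1-ρ))`

Topic `Literature/InformationTheory/QuantumCodes` (venture QEC, LADDER-QEC rung Q5, PARTITION row 09; qec-type-09 gen 6,
cell item «09.RSCINH»). All PROVED, kernel axioms, no named fact. `RotatedSurfaceCodeCrossingPathsBound.lean` proves the DKLP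
counting bound for the `H_X` sector of type-08's rotated surface code `RSC(L)` under i.i.d. flips of one rate `p`. Realistic
noise is inhomogeneous; the tree's Peierls bound for independent non-identically distributed errors
(`InhomogeneousDensityBound.lean`, `sum_indepWeight_le_of_cover`: rates `0 ≤ r v ≤ ρ ≤ 1/2` ⇒ `(2√(ρ(1-ρ)))^{|T|}` per
dense set) carries it to every independent law `indepWeight r` whose rates are bounded by `ρ`, with the same covering family
of rough-to-rough self-avoiding paths of the diagonal lattice (this is the rotated twin of
`PlanarCodeCrossingPathsInhomogeneous.lean`):

* ★ `rsc_sum_indepWeight_oddResidual_le` — `L ≥ 2`: `Σ_{e : odd column-0 residual} w_r(e) ≤ L·C·s^L/(1-s)`;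
* `rsc_tendsto_sum_indepWeight_oddResidual` — along `L = i + 1`, for rate families `r_i(v) ≤ ρ` with `4ν² ρ(1-ρ) < 1`
  these sums tend to `0`.

## References

* [DennisEtAl2002] E. Dennis, A. Kitaev, A. Landahl, J. Preskill, *Topological quantum memory*, J. Math. Phys. 43 (2002)
  4452–4505, arXiv:quant-ph/0110143, §5.2 (eqs. (27)–(28)), §5.3 (eqs. (29), (threshold_2d), (fail_2d); "This change has
  no effect on the estimate of the threshold").
-/

namespace Literature.InformationTheory.QuantumCodes

namespace RotatedSurface

open Finset Matrix Filter Topology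
open Literature.Probability.LatticeModels (Site)
open Literature.Probability.RandomPlanarGeometry
open Literature.Probability.RandomPlanarGeometry.SAW.Zd (saws card_saws)

variable {L : ℕ}

/-- A binary chain is determined by its support. [folklore] -/
private theorem supp_injective_rsc_inhom {V : Type*} [Fintype V] [DecidableEq V] :
    Function.Injective (supp : (V → ZMod 2) → Finset V) := by
  intro e₁ e₂ h
  funext v
  have h1 : v ∈ supp e₁ ↔ v ∈ supp e₂ := by rw [h]
  simp only [supp, Finset.mem_filter, Finset.mem_univ, true_and] at h1
  have key : ∀ x y : ZMod 2, (x ≠ 0 ↔ y ≠ 0) → x = y := by decide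
  exact key _ _ h1

/-- The walk-count constant is at least `1` (`c₀ = 1`), in particular non-negative. [cite: DennisEtAl2002, §5.3 eq. (29)] -/
private theorem nonneg_of_sawCountBound_rsc_inhom {C ν : ℝ} (h : ToricCode.SAWCountBound C ν) : 0 ≤ C := by
  have h0 := h 0
  rw [SAW.count_zero, pow_zero, mul_one, Nat.cast_one] at h0
  linarith

open Classical in
/-- ★ **DKLP's counting bound for the rotated surface code with INHOMOGENEOUS independent noise** (qubit `v` flips with its
own probability `r v`, all `0 ≤ r v ≤ ρ ≤ 1/2`; `L ≥ 2`): for a minimum-weight decoder `D` of the `H_X` sector and a walk-count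
bound `cₙ ≤ C νⁿ` with `s = 2ν√(ρ(1-ρ)) < 1`, the total probability of the errors whose residual has an odd number of
column-`0` qubits is at most `L·C·s^L/(1-s)` — the covering family of rough-to-rough self-avoiding paths
(`rsc_exists_crossing_of_oddResidual`) with the inhomogeneous Peierls bound `(2√(ρ(1-ρ)))ⁿ` per path
(`sum_indepWeight_le_of_cover`). [cite: DennisEtAl2002, §5.2 eqs. (27)–(28), §5.3 eqs. (29), (fail_2d)] -/
theorem rsc_sum_indepWeight_oddResidual_le (hL : 2 ≤ L) {C ν : ℝ} (hν : 0 < ν) (hC : ToricCode.SAWCountBound C ν)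
    {D : Decoder (Fin (L + 1) × Fin (L - 1) → ZMod 2) (Fin L × Fin L → ZMod 2)}
    (hD : D.IsMinWeight (fun e => HX L *ᵥ e) {x | HX L *ᵥ x = 0} hammingNorm)
    {r : Fin L × Fin L → ℝ} {ρ : ℝ} (hr0' : ∀ v, 0 ≤ r v) (hrρ : ∀ v, r v ≤ ρ) (hρ : ρ ≤ 1 / 2)
    (hr1 : 2 * ν * Real.sqrt (ρ * (1 - ρ)) < 1) :
    ∑ e ∈ univ.filter (fun e : Fin L × Fin L → ZMod 2 =>
        ∑ i : Fin L, (D (HX L *ᵥ e) + e) (i, ⟨0, by omega⟩) = 1), indepWeight r (supp e) ≤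
      (L : ℝ) * C * (2 * ν * Real.sqrt (ρ * (1 - ρ))) ^ L / (1 - 2 * ν * Real.sqrt (ρ * (1 - ρ))) := by
  classical
  set s := Real.sqrt (ρ * (1 - ρ)) with hs
  set t := 2 * ν * s with hr
  have hs0 : 0 ≤ s := Real.sqrt_nonneg _
  have hr0 : 0 ≤ t := by rw [hr]; positivity
  have h1r : 0 < 1 - t := by linarith
  have hC0 : 0 ≤ C := nonneg_of_sawCountBound_rsc_inhom hC
  -- Step 1: the odd-residual error chains, reindexed by their supports
  set F := univ.filter (fun e : Fin L × Fin L → ZMod 2 =>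
    ∑ i : Fin L, (D (HX L *ᵥ e) + e) (i, ⟨0, by omega⟩) = 1) with hF
  have hsum : ∑ e ∈ F, indepWeight r (supp e) = ∑ E ∈ F.image supp, indepWeight r E :=
    (Finset.sum_image fun e₁ _ e₂ _ h => supp_injective_rsc_inhom h).symm
  rw [hsum]
  -- Step 2: the covering family — rough-to-rough self-avoiding paths graded by their number of bonds `n ∈ [L, #qubits]`
  set M := Fintype.card (Fin L × Fin L) with hM
  set I : Finset (Σ _ : ℕ, Fin L × (ℕ → Site 2)) :=
    (Finset.Ico L (M + 1)).sigma fun n => (univ : Finset (Fin L)) ×ˢ saws 2 n with hI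
  set Ps : Finset (Σ _ : ℕ, Fin L × (ℕ → Site 2)) := I.filter (fun x => IsRCrossing L x.2.1 x.1 x.2.2) with hPs
  set T : (Σ _ : ℕ, Fin L × (ℕ → Site 2)) → Finset (Fin L × Fin L) := fun x => rPathQubits x.2.1 x.1 x.2.2 with hT
  have hmem : ∀ x ∈ Ps, x.2.2 ∈ saws 2 x.1 ∧ IsRCrossing L x.2.1 x.1 x.2.2 := by
    intro x hx
    rw [hPs, Finset.mem_filter, hI, Finset.mem_sigma, Finset.mem_product] at hx
    exact ⟨hx.1.2.2, hx.2⟩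
  have hcard : ∀ x ∈ Ps, (T x).card = x.1 := fun x hx => card_rPathQubits (hmem x hx).1 (hmem x hx).2
  have hcover : ∀ E ∈ F.image supp, ∃ x ∈ Ps, (T x).card ≤ 2 * (T x ∩ E).card := by
    intro E hE
    obtain ⟨e, he, rfl⟩ := Finset.mem_image.1 hE
    have hodd := (Finset.mem_filter.1 he).2
    obtain ⟨b₀, n, ω, hω, hX, hLn, hhalf⟩ := rsc_exists_crossing_of_oddResidual hL hD hodd
    have hnM : n ≤ M := by
      rw [← card_rPathQubits hω hX]
      exact Finset.card_le_univ _
    refine ⟨⟨n, b₀, ω⟩, ?_, ?_⟩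
    · rw [hPs, Finset.mem_filter, hI, Finset.mem_sigma, Finset.mem_product, Finset.mem_Ico]
      exact ⟨⟨⟨hLn, Nat.lt_succ_of_le hnM⟩, Finset.mem_univ _, hω⟩, hX⟩
    · show (rPathQubits b₀ n ω).card ≤ 2 * (rPathQubits b₀ n ω ∩ supp e).card
      rw [card_rPathQubits hω hX]
      exact hhalf
  have h1 := sum_indepWeight_le_of_cover hr0' hrρ hρ Ps T (F.image supp) hcover
  -- Step 3: `Σ_{paths} (2s)^n ≤ Σ_{n} L · cₙ · (2s)^n`
  have h2 : ∑ x ∈ Ps, (2 * s) ^ (T x).card ≤ ∑ x ∈ I, (2 * s) ^ x.1 :=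
    calc ∑ x ∈ Ps, (2 * s) ^ (T x).card = ∑ x ∈ Ps, (2 * s) ^ x.1 :=
          Finset.sum_congr rfl fun x hx => by rw [hcard x hx]
      _ ≤ ∑ x ∈ I, (2 * s) ^ x.1 :=
          Finset.sum_le_sum_of_subset_of_nonneg (Finset.filter_subset _ _) fun _ _ _ => pow_nonneg (by positivity) _
  have h3 : ∑ x ∈ I, (2 * s) ^ x.1 = ∑ n ∈ Finset.Ico L (M + 1), (L : ℝ) * ((saws 2 n).card : ℝ) * (2 * s) ^ n := by
    rw [hI, Finset.sum_sigma]
    refine Finset.sum_congr rfl fun n _ => ?_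
    show ∑ y ∈ (univ : Finset (Fin L)) ×ˢ saws 2 n, (2 * s) ^ n = _
    rw [Finset.sum_const, Finset.card_product, Finset.card_univ, Fintype.card_fin, nsmul_eq_mul]
    push_cast
    ring
  -- Step 4: `cₙ ≤ C νⁿ` and the geometric tail
  have h4 : ∀ n ∈ Finset.Ico L (M + 1), (L : ℝ) * ((saws 2 n).card : ℝ) * (2 * s) ^ n ≤ (L : ℝ) * C * t ^ n := by
    intro n _
    have hc : ((saws 2 n).card : ℝ) ≤ C * ν ^ n := by
      rw [card_saws, SAW.Zd.count_two]
      exact hC n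
    have hk : (0 : ℝ) ≤ (L : ℝ) := by positivity
    calc (L : ℝ) * ((saws 2 n).card : ℝ) * (2 * s) ^ n ≤ (L : ℝ) * (C * ν ^ n) * (2 * s) ^ n :=
          mul_le_mul_of_nonneg_right (mul_le_mul_of_nonneg_left hc hk) (pow_nonneg (by positivity) _)
      _ = (L : ℝ) * C * t ^ n := by
          rw [hr, mul_pow, mul_pow]
          ring
  have hgeom := geom_tail_le hr0 hr1 L (M + 1)
  calc ∑ E ∈ F.image supp, indepWeight r E
      ≤ ∑ x ∈ Ps, (2 * s) ^ (T x).card := h1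
    _ ≤ ∑ x ∈ I, (2 * s) ^ x.1 := h2
    _ = ∑ n ∈ Finset.Ico L (M + 1), (L : ℝ) * ((saws 2 n).card : ℝ) * (2 * s) ^ n := h3
    _ ≤ ∑ n ∈ Finset.Ico L (M + 1), (L : ℝ) * C * t ^ n := Finset.sum_le_sum h4
    _ = (L : ℝ) * C * ∑ n ∈ Finset.Ico L (M + 1), t ^ n := by rw [Finset.mul_sum]
    _ ≤ (L : ℝ) * C * (t ^ L / (1 - t)) := mul_le_mul_of_nonneg_left hgeom (by positivity)
    _ = (L : ℝ) * C * t ^ L / (1 - t) := by ring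

open Classical in
/-- **The inhomogeneous rotated counting bound tends to zero when all rates are `≤ ρ` with `4ν² ρ(1-ρ) < 1`** along
`L = i + 1` (`cₙ ≤ C νⁿ`; any family of minimum-weight decoders of the `H_X` sectors; qubit- and size-dependent rates
`0 ≤ r_i(v) ≤ ρ ≤ 1/2`). [cite: DennisEtAl2002, §5.3 eqs. (threshold_2d), (fail_2d)] -/
theorem rsc_tendsto_sum_indepWeight_oddResidual {C ν : ℝ} (hν : 0 < ν) (hC : ToricCode.SAWCountBound C ν)
    (D : ∀ i : ℕ, Decoder (Fin (i + 1 + 1) × Fin (i + 1 - 1) → ZMod 2) (Fin (i + 1) × Fin (i + 1) → ZMod 2))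
    (hD : ∀ i, (D i).IsMinWeight (fun e => HX (i + 1) *ᵥ e) {x | HX (i + 1) *ᵥ x = 0} hammingNorm)
    {rate : ∀ i, Fin (i + 1) × Fin (i + 1) → ℝ} {ρ : ℝ} (hR0 : ∀ i v, 0 ≤ rate i v) (hRρ : ∀ i v, rate i v ≤ ρ)
    (hρ0 : 0 ≤ ρ) (hρ : ρ ≤ 1 / 2) (h4 : 4 * ν ^ 2 * (ρ * (1 - ρ)) < 1) :
    Tendsto (fun i => ∑ e ∈ univ.filter (fun e : Fin (i + 1) × Fin (i + 1) → ZMod 2 =>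
        ∑ j : Fin (i + 1), (D i (HX (i + 1) *ᵥ e) + e) (j, ⟨0, by omega⟩) = 1), indepWeight (rate i) (supp e))
      atTop (𝓝 0) := by
  set s := Real.sqrt (ρ * (1 - ρ)) with hs
  set r := 2 * ν * s with hr
  have hs0 : 0 ≤ s := Real.sqrt_nonneg _
  have hr0 : 0 ≤ r := by rw [hr]; positivity
  have hpp : 0 ≤ ρ * (1 - ρ) := mul_nonneg hρ0 (by linarith)
  have hr1 : r < 1 := by
    have hsq : r ^ 2 = 4 * ν ^ 2 * (ρ * (1 - ρ)) := by
      rw [hr, mul_pow, mul_pow, hs, Real.sq_sqrt hpp]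
      ring
    have h : r ^ 2 < 1 := by rw [hsq]; exact h4
    have := (sq_lt_one_iff_abs_lt_one r).1 h
    rwa [abs_of_nonneg hr0] at this
  have h1r : 0 < 1 - r := by linarith
  have hC0 : 0 ≤ C := nonneg_of_sawCountBound_rsc_inhom hC
  have hbound : ∀ i : ℕ, 1 ≤ i → (∑ e ∈ univ.filter (fun e : Fin (i + 1) × Fin (i + 1) → ZMod 2 =>
        ∑ j : Fin (i + 1), (D i (HX (i + 1) *ᵥ e) + e) (j, ⟨0, by omega⟩) = 1), indepWeight (rate i) (supp e)) ≤
      ((i + 1 : ℕ) : ℝ) * C * r ^ (i + 1) / (1 - r) :=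
    fun i hi => rsc_sum_indepWeight_oddResidual_le (L := i + 1) (by omega) hν hC (hD i) (hR0 i) (hRρ i) hρ hr1
  have hnonneg : ∀ i : ℕ, 0 ≤ ∑ e ∈ univ.filter (fun e : Fin (i + 1) × Fin (i + 1) → ZMod 2 =>
        ∑ j : Fin (i + 1), (D i (HX (i + 1) *ᵥ e) + e) (j, ⟨0, by omega⟩) = 1), indepWeight (rate i) (supp e) :=
    fun i => Finset.sum_nonneg fun e _ => indepWeight_nonneg (hR0 i) (fun v => (hRρ i v).trans (by linarith)) _
  have hlim : Tendsto (fun i : ℕ => ((i + 1 : ℕ) : ℝ) * C * r ^ (i + 1) / (1 - r)) atTop (𝓝 0) := by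
    have h0 := tendsto_pow_const_mul_const_pow_of_abs_lt_one 1 (show |r| < 1 by rwa [abs_of_nonneg hr0])
    have h1 : Tendsto (fun i : ℕ => ((i + 1 : ℕ) : ℝ) ^ 1 * r ^ (i + 1)) atTop (𝓝 0) :=
      (Filter.tendsto_add_atTop_iff_nat 1).2 h0
    have h2 := h1.const_mul (C / (1 - r))
    rw [mul_zero] at h2
    refine h2.congr fun i => ?_
    have h1r0 : 1 - r ≠ 0 := h1r.ne'
    field_simp
  refine squeeze_zero' (Filter.Eventually.of_forall hnonneg) ?_ hlim
  rw [Filter.eventually_atTop]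
  exact ⟨1, fun i hi => hbound i hi⟩

end RotatedSurface

end Literature.InformationTheory.QuantumCodes
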